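import Mathlib
import Summits.ValiantsHypothesis.ValiantsHypothesis.Theorems.GrenetZeonTwoDimCoefficientsScalingShadowFamilyGeneral
import Summits.ValiantsHypothesis.ValiantsHypothesis.Theorems.GrenetZeonTwoDimCoefficientsScalingRayDisc

/-!
# Crux `GrenetZeon.TwoDimCoefficients` (stmt-ValiantsHypothesis-8062), stub `stub_dualUnipotent`:
# scaling-closure — RAY INTERPOLATION for an arbitrary affine pair (per-free engine, lemma F1b of EIGHTEENTH-HAND.md)

✓ `rank_hess0_perPoly_le_of_simpleRayRoots` (17th hand) bounds `rank Hess per_n(z₀) ≤ J·2m` at points `z₀` where the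
ray polynomial of a unipotent dual REPRESENTATION of `per_n` has `J` simple roots.  The numerator-perturbation argument
(memo EIGHTEENTH-HAND.md, §NEW) runs the engine on the NON-representation `(A, B + θ·C)`; the only change is that the
first graded piece of the shadow is `[D_1]_n` (there: `β⁻¹per_n + θ·q`) instead of `β⁻¹per_n`:

* ★ `rank_hess0_top_le_of_simpleRayRoots` — affine `A, B` (`n ≥ 2`, `1 ≤ J ≤ m`) with `D_0 = c` and `[D_k]_d = 0`
  for `d > k·n` (all `k`), companions vanishing above order `J`; if at `z₀` the ray polynomial
  `R(t) = c + Σ_{k ≤ J} [D_k]_{kn}(z₀)·t^k` has `J` distinct simple roots, then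
  `rank Hess [D_1]_n (z₀) ≤ J·(2m)`.
  (Shadow family ✓ `exists_shadowFamily_general`; Euler ⟹ the ray zeros are smooth; MR on the shadow;
  diag·Vandermonde nodes ✓ `rank_hess0_le_of_rayNodes` — verbatim the 17th hand's proof.)

HONEST FRAMING: engine generalisation only; the stub `DualUnipotentBound`, both cruxes (stmt-8062, stmt-24318) and
`VP ≠ VNP` remain open.

References: T. Mignon, N. Ressayre, Int. Math. Res. Not. 2004:79, Thm. 1.1 (via the tree); folklore.
-/

-- single-conjunct layout `Summits/ValiantsHypothesis/ValiantsHypothesis`: the duplicated namespace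
-- component is mandated by the tree.
set_option linter.dupNamespace false
set_option autoImplicit false

noncomputable section

namespace Summit.ValiantsHypothesis.ValiantsHypothesis.Theorems.GrenetZeonTwoDimCoefficients.ScalingClosure

open MvPolynomial Matrix
open Literature.Computability.AlgebraicComplexity
open Summit.ValiantsHypothesis.ValiantsHypothesis.Cruxes.TwoDimCoefficients.DimTwoCases

section RayGeneral

variable {n m : ℕ}

/-- ★ **Ray interpolation at all orders, arbitrary affine pair.**  Affine `A, B` with `D_0 = c`, `[D_k]_d = 0` for
`d > k·n` (all `k`), companions vanishing above order `J` (`1 ≤ J ≤ m`, `n ≥ 2`); if at `z₀` the ray polynomial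
`c + Σ_{k=1}^{J} [D_k]_{kn}(z₀)t^k` has `J` distinct simple roots `t_i`, then `rank Hess [D_1]_n(z₀) ≤ J·(2m)`.
[cite: MignonRessayre2004, Thm. 1.1 — via the tree; folklore] -/
theorem rank_hess0_top_le_of_simpleRayRoots (A B : AffMat n m) (hA : IsAffine A) (hB : IsAffine B)
    (c : ℂ) (hn : 2 ≤ n) (D : ℕ → MvPolynomial (Fin n × Fin n) ℂ)
    (hD : ∀ k, D k = (det ((Polynomial.X : Polynomial (MvPolynomial (Fin n × Fin n) ℂ)) •
      B.map Polynomial.C + A.map Polynomial.C)).coeff k)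
    (hD0 : D 0 = MvPolynomial.C c)
    (hdeg : ∀ k, ∀ d, k * n < d → homogeneousComponent d (D k) = 0)
    {J : ℕ} (hJ1 : 1 ≤ J) (hJm : J ≤ m) (hJ : ∀ k, J < k → k ≤ m → homogeneousComponent (k * n) (D k) = 0)
    (z₀ : Fin n × Fin n → ℂ) (t : Fin J → ℂ) (ht : Function.Injective t)
    (hroot : ∀ i, c + ∑ e : Fin J, t i ^ ((e : ℕ) + 1) * eval z₀ (homogeneousComponent (((e : ℕ) + 1) * n) (D (e + 1)))
      = 0)
    (hsimple : ∀ i, ∑ e : Fin J, (((e : ℕ) + 1 : ℕ) : ℂ) * (t i ^ ((e : ℕ) + 1) *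
      eval z₀ (homogeneousComponent (((e : ℕ) + 1) * n) (D (e + 1)))) ≠ 0) :
    (hess0 (transl z₀ (homogeneousComponent n (D 1)))).rank ≤ J * (2 * m) := by
  classical
  -- the graded pieces of the shadow
  set Ψ : Fin J → MvPolynomial (Fin n × Fin n) ℂ := fun e =>
    homogeneousComponent (((e : ℕ) + 1) * n) (D (e + 1)) with hΨdef
  set d : Fin J → ℕ := fun e => ((e : ℕ) + 1) * n with hddef
  have hΨ_hom : ∀ e, (Ψ e).IsHomogeneous (d e) := fun e => homogeneousComponent_isHomogeneous _ _
  set Φ : MvPolynomial (Fin n × Fin n) ℂ := MvPolynomial.C c + ∑ e, Ψ e with hΦ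
  -- identify with the special fibre of `exists_shadowFamily_general`
  obtain ⟨Pf, h0, hMR⟩ := exists_shadowFamily_general A B hA hB D hD hdeg
  have hshape : (∑ k ∈ Finset.range (m + 1), homogeneousComponent (k * n) (D k)) = Φ := by
    have hsumJ : (∑ k ∈ Finset.range (m + 1), homogeneousComponent (k * n) (D k)) =
        ∑ k ∈ Finset.range (J + 1), homogeneousComponent (k * n) (D k) := by
      rw [Finset.range_eq_Ico, Finset.range_eq_Ico,
        ← Finset.sum_Ico_consecutive _ (Nat.zero_le (J + 1)) (by omega : J + 1 ≤ m + 1)]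
      conv_rhs => rw [← add_zero (∑ k ∈ Finset.Ico 0 (J + 1), _)]
      congr 1
      refine Finset.sum_eq_zero fun k hk => ?_
      rw [Finset.mem_Ico] at hk
      exact hJ k (by omega) (by omega)
    have hΦsum : (∑ e : Fin J, Ψ e) = ∑ k ∈ Finset.range J, homogeneousComponent ((k + 1) * n) (D (k + 1)) :=
      Fin.sum_univ_eq_sum_range (fun k => homogeneousComponent ((k + 1) * n) (D (k + 1))) J
    rw [hsumJ, hΦ, hΦsum, Finset.sum_range_succ' _ J, zero_mul, hD0, homogeneousComponent_zero, coeff_C,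
      if_pos rfl, add_comm]
  have h0' : ∀ z : Fin n × Fin n → ℂ, eval (fun o : Option (Fin n × Fin n) => o.elim (0 : ℂ) z) Pf = eval z Φ := by
    intro z; rw [h0 z, hshape]
  have hnode : ∀ z, eval z Φ = 0 → (∃ i, eval z (pderiv i Φ) ≠ 0) → (hess0 (transl z Φ)).rank ≤ 2 * m := by
    rintro z hz ⟨i, hi⟩
    exact rank_hess0_shadow_le Pf Φ (2 * m) h0' hMR z hz i hi
  -- ray parameters
  have hl : ∀ i, ∃ l : ℂ, l ^ n = t i := fun i => IsAlgClosed.exists_pow_nat_eq (t i) (by omega)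
  choose l hl using hl
  have ht0 : ∀ i, t i ≠ 0 := by
    intro i hti
    have h := hsimple i
    simp only [hti, zero_pow (Nat.succ_ne_zero _), zero_mul, mul_zero, Finset.sum_const_zero] at h
    exact h rfl
  have hl0 : ∀ i, l i ≠ 0 := fun i h => ht0 i (by rw [← hl i, h, zero_pow (by omega)])
  -- node bounds on the rays
  have hnodes : ∀ i, (hess0 (transl (l i • z₀) (MvPolynomial.C c + ∑ e, Ψ e))).rank ≤ 2 * m := by
    intro i
    have hpow : ∀ e : Fin J, l i ^ d e = t i ^ ((e : ℕ) + 1) := fun e => by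
      rw [hddef]; simp only; rw [mul_comm, pow_mul, hl i]
    refine hnode _ ?_ ?_
    · rw [map_add, MvPolynomial.eval_C, map_sum, ← hroot i]
      congr 1
      exact Finset.sum_congr rfl fun e _ => by rw [eval_smul_of_isHomogeneous _ (hΨ_hom e), hpow]
    · by_contra hno
      push Not at hno
      have he := euler_eval_sum_eq_zero_of_pderiv_eq_zero c Ψ d hΨ_hom (l i • z₀) hno
      apply hsimple i
      have hn0 : (n : ℂ) ≠ 0 := Nat.cast_ne_zero.mpr (by omega)
      have : ∑ e : Fin J, (d e : ℂ) * eval (l i • z₀) (Ψ e) =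
          (n : ℂ) * ∑ e : Fin J, (((e : ℕ) + 1 : ℕ) : ℂ) * (t i ^ ((e : ℕ) + 1) * eval z₀ (Ψ e)) := by
        rw [Finset.mul_sum]
        refine Finset.sum_congr rfl fun e _ => ?_
        rw [eval_smul_of_isHomogeneous _ (hΨ_hom e), hpow, hddef]
        push_cast
        ring
      rw [this] at he
      exact (mul_eq_zero.mp he).resolve_left hn0
  -- the generalized Vandermonde `λ_i^{d_e − 2} = λ_i^{n−2}·t_i^e`
  set V : Matrix (Fin J) (Fin J) ℂ := Matrix.of fun (i : Fin J) (e : Fin J) => l i ^ (d e - 2) with hV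
  have hVeq : V = Matrix.diagonal (fun i => l i ^ (n - 2)) * Matrix.vandermonde t := by
    ext i e
    rw [Matrix.diagonal_mul, Matrix.vandermonde_apply, hV, Matrix.of_apply, hddef]
    simp only
    rw [show ((e : ℕ) + 1) * n - 2 = (n - 2) + (e : ℕ) * n by
        rw [Nat.add_mul, one_mul]; omega, pow_add, mul_comm (e : ℕ) n, pow_mul, hl i]
  have hVdet : IsUnit V.det := by
    rw [hVeq, Matrix.det_mul, Matrix.det_diagonal]
    refine isUnit_iff_ne_zero.mpr (mul_ne_zero ?_ (Matrix.det_vandermonde_ne_zero_iff.mpr ht))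
    exact Finset.prod_ne_zero_iff.mpr fun i _ => pow_ne_zero _ (hl0 i)
  have hWV : V⁻¹ * V = 1 := Matrix.nonsing_inv_mul V hVdet
  -- interpolate
  obtain ⟨J', rfl⟩ : ∃ J', J = J' + 1 := ⟨J - 1, by omega⟩
  have h := rank_hess0_le_of_rayNodes c Ψ d hΨ_hom z₀ l (2 * m) hnodes V⁻¹ (by rw [hV] at hWV ⊢; exact hWV)
    (0 : Fin (J' + 1))
  have hΨ0 : Ψ 0 = homogeneousComponent n (D 1) := by
    rw [hΨdef]; simp only [Fin.val_zero, zero_add, one_mul]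
  rw [hΨ0, Fintype.card_fin] at h
  exact h

end RayGeneral

end Summit.ValiantsHypothesis.ValiantsHypothesis.Theorems.GrenetZeonTwoDimCoefficients.ScalingClosure

end
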